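import Summits.CriticalPhenomena.CardyFormulaZ2.Theorems.CardyIKTransportIKLinearTransportStubConditionalRSW
import Summits.CriticalPhenomena.CardyFormulaZ2.Theorems.CardyIKTransportIKLinearTransportStubCouplingToLimitsEvents
import Literature.Probability.Percolation.CornerPercolation

/-!
# Line `pinned-diagram-exchange` of crux `CardyIKTransport.IKLinearTransport` (stmt-CriticalPhenomena-5076):
# glue of the v3 reshape of stub 6 (`CrudeCardyTri` = `TriLawOfEmpty` + `CrudeCardySiteTri`)

Support file (`--supports stmt-CriticalPhenomena-5076`) extending the landed vocabulary
`Theorems/CardyIKTransportIKLinearTransportLine.lean` (p74749; kept byte-identical, this is a new file because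
that one is at its 400-line budget). The lead's skeleton v3 (`Cruxes/IKLinearTransport/Lines/pinned-diagram-exchange.lean`,
registered 2026-08-16) splits the v2 stub `stub_CrudeCardyTri : ∃ K₀, IsTriShear K₀ ∧ CrudeCardyAlong K₀ ∅` into

* `stub_TriLawOfEmpty : Measurable (blackSet ∅) ∧ μIK.map (blackSet ∅) = sitePercolation (Site 2) half` — the
  colour field of the `S = ∅` member is i.i.d. fair (LANDED, p83265), and
* `stub_CrudeCardySiteTri : ∃ K₀, IsTriShear K₀ ∧ ∀ R, HasCrossingLimit (R.map K₀) (fun δ ↦ (sitePercolation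
  (Site 2) half).real (siteTriCrudeEvent R δ)) cardyFunction` — crude Cardy for fair site percolation on
  `triGraph` drawn on the square grid, read in the images of the explicit shear `K₀` (`K₀ ∘ sqEmb = triEmbed`),

and this file supplies the event `siteTriCrudeEvent`, its measurability, and the sorry-free glue
`crudeCardyTri_of : (6a) → (6b) → ∃ K₀, IsTriShear K₀ ∧ CrudeCardyAlong K₀ ∅`. Nothing here is a literature
fact; `siteTriCrudeEvent` is an object the line posits (the registered signature of stub 6b names it). Reused
from the landed stub files: `crsw_obs_empty_eq` (`…StubConditionalRSW.lean`) and
`CouplingToLimits.measurable_blackEdges` (`…StubCouplingToLimitsEvents.lean`).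

References: the line card `Cruxes/IKLinearTransport/Lines/pinned-diagram-exchange.md`; S. Smirnov, C. R. Acad.
Sci. 333 (2001) §2 (crossing events); G. Grimmett, I. Manolescu, PTRF 159 (2014) §2.2 (embedded crossing events).
-/

noncomputable section

namespace Summit.CriticalPhenomena.CardyFormulaZ2.Theorems.IKLinearTransport.PinnedDiagramExchange

open scoped Topology Classical MeasureTheory
open Filter Set Function MeasureTheory
open Literature.Probability.Percolation Literature.Probability.LatticeModels
open Literature.Probability.RandomPlanarGeometry

/-- The crude crossing event of `R` at mesh `δ` read on a COLOUR configuration `A ⊆ ℤ²` of the all-anti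
triangulation (`cellGraph univ = triGraph`): black `triGraph`-edges, square drawing `sqEmb`; the event of the
registered stub `stub_CrudeCardySiteTri`. [folklore] -/
def siteTriCrudeEvent (R : ConformalRectangle) (δ : ℝ) : Set (Set (Site 2)) :=
  {A | blackEdges (A, (Set.univ : Set (Site 2))) ∈ embDomainCrossing sqEmb R.carrier δ (R.arc 0) (R.arc 2)}

/-- The colour-level crude event is measurable (`blackEdges` is measurable on the observables and the crude
event of a countable graph is measurable). [folklore] -/
theorem measurableSet_siteTriCrudeEvent (R : ConformalRectangle) (δ : ℝ) :
    MeasurableSet (siteTriCrudeEvent R δ) :=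
  (CouplingToLimits.measurable_blackEdges.comp (measurable_id.prodMk measurable_const))
    (measurableSet_embDomainCrossing sqEmb R.carrier δ (R.arc 0) (R.arc 2))

/-- GLUE of the v3 reshape: the colour-law identification (`stub_TriLawOfEmpty`) and crude Cardy for fair
site-`𝕋` (`stub_CrudeCardySiteTri`) give the v2 stub `∃ K₀, IsTriShear K₀ ∧ CrudeCardyAlong K₀ ∅`
(`mixedCrossingProb ∅ R δ` is the `μIK`-measure of the `blackSet ∅`-preimage of `siteTriCrudeEvent R δ`,
`crsw_obs_empty_eq`, and `Measure.map_apply`). [folklore] -/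
theorem crudeCardyTri_of :
    (Measurable (blackSet (∅ : Set ℤ)) ∧ μIK.map (blackSet ∅) = sitePercolation (Site 2) half) →
    (∃ K₀ : ℂ ≃L[ℝ] ℂ, IsTriShear K₀ ∧ ∀ R : ConformalRectangle,
      ConformalRectangle.HasCrossingLimit (R.map K₀.toHomeomorph)
        (fun δ => (sitePercolation (Site 2) half).real (siteTriCrudeEvent R δ))
        Literature.Probability.RandomPlanarGeometry.cardyFunction) →
    ∃ K₀ : ℂ ≃L[ℝ] ℂ, IsTriShear K₀ ∧ CrudeCardyAlong K₀ ∅ := by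
  intro hLaw hSite
  obtain ⟨K₀, hK₀, h⟩ := hSite
  refine ⟨K₀, hK₀, fun R => ?_⟩
  have hEq : mixedCrossingProb ∅ R = fun δ => (sitePercolation (Site 2) half).real (siteTriCrudeEvent R δ) := by
    funext δ
    have hset : {ω : Ω | blackEdges (obs ∅ ω) ∈ embDomainCrossing sqEmb R.carrier δ (R.arc 0) (R.arc 2)} =
        blackSet ∅ ⁻¹' siteTriCrudeEvent R δ := by
      ext ω; simp [siteTriCrudeEvent, crsw_obs_empty_eq]
    rw [mixedCrossingProb, hset, ← hLaw.2, Measure.real, Measure.real,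
      Measure.map_apply hLaw.1 (measurableSet_siteTriCrudeEvent R δ)]
  rw [hEq]
  exact h R

end Summit.CriticalPhenomena.CardyFormulaZ2.Theorems.IKLinearTransport.PinnedDiagramExchange
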